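import Literature.Combinatorics.SimpleGraph.HarmonicOneFormsFlowSpace
import Literature.Combinatorics.SimpleGraph.HyperellipticInvolutionJacobian
import HarnessLib

/-!
# Theorem 58 (5) ⇒ (1): an involution acting as `−1` on the harmonic 1-forms is the
# hyperelliptic involution (Baker–Norine 2009, §5.3)

Source (held, read at the page; statements VERBATIM). M. Baker, S. Norine, *Harmonic morphisms
and hyperelliptic graphs*, Int. Math. Res. Not. IMRN 2009 [BakerNorine2009] (held text
`paper:arxiv-0707.1309`, chunks p0019–p0020). **Theorem 58.** «Let `G` be a 2-edge-connected
graph of genus `g ≥ 2`, and let `ι ∈ Aut(G)`. Then the following are equivalent: (1) `G` is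
hyperelliptic with hyperelliptic involution `ι`. […] (5) `ι^* : 𝓗¹(G) → 𝓗¹(G)` is
multiplication by `−1`.» Proof of (5) ⇒ (1): «Suppose `ι^* ≡ −1` on `𝓗¹(G)`. Then `(ι²)^*` is
the identity map on `𝓗¹(G)`, so `ι` is an involution by Proposition 36. If `ι(e) = e` for some
directed edge `e`, then letting `ω` be the characteristic function of any simple cycle containing
`e`, we have `ω(e) = ω(ι(e)) = (ι^*ω)(e) = −ω(e)`, so `ω(e) = 0`, a contradiction. Therefore `ι`
is mixing. […] By Lemma 45, we know that `π := ι^∼ : G → G′ := G/ι` is a non-degenerate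
harmonic morphism of degree 2. It remains to show that `G′` is a tree. Since `π ∘ ι = π`, we have
`ι^*(π^*(ω′)) = π^*(ω′)` for every `ω′ ∈ 𝓗¹(G′)` by functoriality. Since `ι^* ≡ −1` on `𝓗¹(G)`,
we conclude that `π^*(ω′) = −π^*(ω′)`, and therefore `π^*(ω′) = 0`, for every `ω′ ∈ 𝓗¹(G′)`.
But `π^* : 𝓗¹(G′) → 𝓗¹(G)` is injective, so it follows that `𝓗¹(G′) = 0`, i.e., `G′` is a
tree.»

## What is formalised (vocabulary of `HarmonicOneForms`, `HarmonicOneFormsFlowSpace`,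
## `GraphInvolutionQuotient`, `HyperellipticInvolution`; flows with values in an integral domain
## `R` of characteristic `0`, e.g. `ℤ` or `ℝ`)

For an involutive automorphism `ι` (the conclusion of Proposition 36 is ASSUMED: that proposition
is not typed) with simple edge orbits (the simple-graph quotient setting of
`GraphInvolutionQuotient`):
* `isGraphFlow_ofEdgeVec_walkVec` — «the characteristic function of a simple cycle» is a flow,
  non-zero on the cycle's edges;
* **`isMixing_of_forall_flow`** — (5) ⇒ «`ι` is mixing» (2-edge-connected `G`);
* **`isAcyclic_quotientGraph_of_forall_flow`** — (5) ⇒ «`𝓗¹(G′) = 0`, i.e., `G′` is a tree»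
  (through Proposition 34 (1) and the injectivity of `π^*`, Corollary 35);
* **Theorem 58 (1) ⇔ (5)** `isTree_quotientGraph_iff_forall_flow` (with
  `IsGraphFlow.apply_tree_involution` for (1) ⇒ (5)) and `isHyperelliptic_of_forall_flow`;
* **Theorem 58 (2) ⇔ (5), (3) ⇔ (5)** `jacPushforward_eq_neg_iff_forall_flow`,
  `jacPullback_eq_neg_iff_forall_flow` (through Theorem 58 (1) ⇔ (2) ⇔ (3) of
  `HyperellipticInvolutionJacobian`).

Theorems only; no `sorry`; no named facts; no instances.
-/

open Finset SimpleGraph Matrix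
open Literature.Combinatorics.SimpleGraph.ChipFiring
open Literature.Combinatorics.SimpleGraph.OrientedIncidence

namespace Literature.Combinatorics.SimpleGraph.BakerNorine

variable {V : Type*} [Fintype V] [DecidableEq V] {G : SimpleGraph V} [DecidableRel G.Adj]
variable {R : Type*} [CommRing R]

/-! ### §1 «The characteristic function of a simple cycle» -/

/-- The signed characteristic vector of a closed walk, read as a 1-cochain, is a flow.
[cite: BakerNorine2009, Theorem 58 (proof of (5) ⇒ (1): «letting `ω` be the characteristic
function of any simple cycle»)] -/
theorem isGraphFlow_ofEdgeVec_walkVec (σ : Orientation G) {u : V} (c : G.Walk u u) :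
    IsGraphFlow G (ofEdgeVec σ (σ.walkVec R c)) :=
  (mem_flowSpace_iff_isGraphFlow σ _).1 (σ.walkVec_mem_flowSpace R c)

omit [Fintype V] in
/-- `ofEdgeVec σ x` is `± x(e)` on the darts of `e`, so non-zero where `x` is.
[cite: BakerNorine2009, §4.3] -/
theorem ofEdgeVec_apply_ne_zero (σ : Orientation G) {x : G.edgeSet → R} {a b : V} (h : G.Adj a b)
    (hx : x ⟨s(a, b), h⟩ ≠ 0) : ofEdgeVec σ x a b ≠ 0 := by
  by_cases hh : σ.head ⟨s(a, b), h⟩ = b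
  · rw [ofEdgeVec_apply_of_head_eq σ x h hh]
    exact hx
  · rw [ofEdgeVec_apply_of_head_ne σ x h hh, neg_ne_zero]
    exact hx

omit [Fintype V] in
/-- The cycle flow is non-zero on the edges of the (simple) cycle. [cite: BakerNorine2009,
Theorem 58 (proof of (5) ⇒ (1))] -/
theorem ofEdgeVec_walkVec_apply_ne_zero [Nontrivial R] (σ : Orientation G) {u a b : V}
    {c : G.Walk u u} (hc : c.IsTrail) (h : G.Adj a b) (he : s(a, b) ∈ c.edges) :
    ofEdgeVec σ (σ.walkVec R c) a b ≠ 0 := by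
  refine ofEdgeVec_apply_ne_zero σ h ?_
  rcases σ.walkVec_apply_of_isTrail R hc (e := ⟨s(a, b), h⟩) he with h1 | h1
  · rw [h1]
    exact one_ne_zero
  · rw [h1, neg_ne_zero]
    exact one_ne_zero

/-! ### §2 (5) ⇒ `ι` is mixing -/

/-- **Theorem 58, (5) ⇒ «`ι` is mixing»**: in a 2-edge-connected graph an edge with both ends fixed
by `ι` lies on a simple cycle, whose flow `ω` would satisfy «`ω(e) = ω(ι(e)) = (ι^*ω)(e) = −ω(e)`,
so `ω(e) = 0`, a contradiction». [cite: BakerNorine2009, Theorem 58 (proof of (5) ⇒ (1))] -/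
theorem isMixing_of_forall_flow [IsDomain R] [CharZero R] (h2 : G.IsEdgeConnected 2) {ι : V → V}
    (h5 : ∀ ω : V → V → R, IsGraphFlow G ω → ∀ u x, ω (ι u) (ι x) = -ω u x) : IsMixing G ι := by
  intro x y hxy hx hy
  -- the edge `xy` is not a bridge, so it lies on a cycle
  have hnb : ¬G.IsBridge s(x, y) := fun hb =>
    isBridge_iff.1 hb ((isEdgeConnected_two.1 h2 s(x, y)) x y)
  rw [isBridge_iff_forall_cycle_notMem (G.mem_edgeSet.2 hxy)] at hnb
  push Not at hnb
  obtain ⟨u, c, hc, he⟩ := hnb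
  set σ := someOrientation G
  have hω := isGraphFlow_ofEdgeVec_walkVec (R := R) σ c
  have hne := ofEdgeVec_walkVec_apply_ne_zero (R := R) σ hc.isTrail hxy he
  have h' := h5 _ hω x y
  rw [hx, hy] at h'
  have h0 : ofEdgeVec σ (σ.walkVec R c) x y + ofEdgeVec σ (σ.walkVec R c) x y = 0 := by
    nth_rewrite 1 [h']
    exact neg_add_cancel _
  exact hne (add_self_eq_zero.1 h0)

/-! ### §3 (5) ⇒ `G/ι` is a tree -/

/-- **Theorem 58, (5) ⇒ «`𝓗¹(G′) = 0`, i.e., `G′` is a tree»** (`G′ = G/ι`): for a flow `ω′` on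
`G/ι`, `π^*ω′` is a flow on `G` with `ι^*(π^*ω′) = π^*ω′` («since `π ∘ ι = π`»), so (5) forces
`π^*ω′ = −π^*ω′ = 0` and `ω′ = 0` by the injectivity of `π^*`; a cycle of `G/ι` would carry a
non-zero flow. [cite: BakerNorine2009, Theorem 58 (proof of (5) ⇒ (1))] -/
theorem isAcyclic_quotientGraph_of_forall_flow [IsDomain R] [CharZero R] (hG : G.Connected)
    {ι : V → V} (hι : IsInvolutiveAut G ι) (hm : IsMixing G ι) (hs : HasSimpleEdgeOrbits G ι)
    (h5 : ∀ ω : V → V → R, IsGraphFlow G ω → ∀ u x, ω (ι u) (ι x) = -ω u x) :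
    (quotientGraph G ι).IsAcyclic := by
  classical
  letI : Fintype (Quotient (orbitRel ι)) := Fintype.ofFinite _
  intro v c hc
  have hπ : IsOrbitMap ι (Quotient.mk (orbitRel ι)) := isOrbitMap_quotientMk hι.involutive
  have hharm : IsHarmonicMorphism G (quotientGraph G ι) (Quotient.mk (orbitRel ι)) :=
    hπ.isHarmonicMorphism hι hm hs
  have hT : (quotientGraph G ι).Connected := imageGraph_connected hπ.surjective hG
  -- `π` is non-constant: the cycle has an edge `v c.snd`
  have hadj : (quotientGraph G ι).Adj v c.snd := c.adj_snd hc.not_nil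
  obtain ⟨x₁, hx₁⟩ := hπ.surjective v
  obtain ⟨x₂, hx₂⟩ := hπ.surjective c.snd
  have hne : Quotient.mk (orbitRel ι) x₁ ≠ Quotient.mk (orbitRel ι) x₂ := by
    rw [hx₁, hx₂]
    exact hadj.ne
  -- the flow of the cycle `c` on `G/ι`
  set τ := someOrientation (quotientGraph G ι)
  set ω' := ofEdgeVec τ (τ.walkVec R c) with hω'def
  have hω' : IsGraphFlow (quotientGraph G ι) ω' := isGraphFlow_ofEdgeVec_walkVec τ c
  -- `π^* ω′` is a flow on `G`, fixed by `ι^*`, hence zero by (5)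
  have hpull := hω'.pullback hharm
  have h0 : cochainPullback G (Quotient.mk (orbitRel ι)) ω' = 0 := by
    funext u x
    have h' := h5 _ hpull u x
    have hfix : cochainPullback G (Quotient.mk (orbitRel ι)) ω' (ι u) (ι x) =
        cochainPullback G (Quotient.mk (orbitRel ι)) ω' u x := by
      rw [cochainPullback_apply, cochainPullback_apply, hπ.apply_ι, hπ.apply_ι]
      by_cases hux : G.Adj u x
      · rw [if_pos hux, if_pos (hι.adj_iff.2 hux)]
      · rw [if_neg hux, if_neg (fun h => hux (hι.adj_iff.1 h))]
    rw [hfix] at h'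
    have hsum : cochainPullback G (Quotient.mk (orbitRel ι)) ω' u x +
        cochainPullback G (Quotient.mk (orbitRel ι)) ω' u x = 0 := by
      nth_rewrite 1 [h']
      exact neg_add_cancel _
    exact add_self_eq_zero.1 hsum
  have hzero : ω' = 0 := hharm.cochainPullback_injective hG hT hne hω'.toIsOneCochain h0
  -- but the cycle flow is non-zero on the edge `v c.snd`
  exact ofEdgeVec_walkVec_apply_ne_zero τ hc.isTrail hadj (c.mk_start_snd_mem_edges hc.not_nil)
    (by rw [← hω'def, hzero]; rfl)

/-! ### §4 Theorem 58 (1) ⇔ (5) -/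

/-- **Theorem 58, (5) ⇒ (1)** in the form of Theorem 51 (2): for a connected 2-edge-connected
graph and an involutive automorphism `ι` with simple edge orbits, if `ι^*ω = −ω` for every flow
`ω` then `G/ι` is a tree. [cite: BakerNorine2009, Theorem 58 ((5) ⇒ (1))] -/
theorem isTree_quotientGraph_of_forall_flow [IsDomain R] [CharZero R] (hG : G.Connected)
    (h2 : G.IsEdgeConnected 2) {ι : V → V} (hι : IsInvolutiveAut G ι)
    (hs : HasSimpleEdgeOrbits G ι)
    (h5 : ∀ ω : V → V → R, IsGraphFlow G ω → ∀ u x, ω (ι u) (ι x) = -ω u x) :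
    (quotientGraph G ι).IsTree := by
  have hπ : IsOrbitMap ι (Quotient.mk (orbitRel ι)) := isOrbitMap_quotientMk hι.involutive
  exact (isTree_iff _).2 ⟨imageGraph_connected hπ.surjective hG,
    isAcyclic_quotientGraph_of_forall_flow hG hι (isMixing_of_forall_flow h2 h5) hs h5⟩

/-- **Theorem 58 (1) ⇔ (5)** (tree-involution form of (1), Theorem 51 / Corollary 54): `G/ι` is a
tree iff `ι^* = −1` on the `R`-valued flows, for an involutive automorphism `ι` with simple edge
orbits of a connected 2-edge-connected graph. [cite: BakerNorine2009, Theorem 58 ((1) ⇔ (5))] -/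
theorem isTree_quotientGraph_iff_forall_flow [IsDomain R] [CharZero R] (hG : G.Connected)
    (h2 : G.IsEdgeConnected 2) {ι : V → V} (hι : IsInvolutiveAut G ι)
    (hs : HasSimpleEdgeOrbits G ι) :
    (quotientGraph G ι).IsTree ↔
      ∀ ω : V → V → R, IsGraphFlow G ω → ∀ u x, ω (ι u) (ι x) = -ω u x :=
  ⟨fun hT _ hω u x => hω.apply_tree_involution h2 hι hT hs u x,
    isTree_quotientGraph_of_forall_flow hG h2 hι hs⟩

/-- **Theorem 58, (5) ⇒ (1)**: under the same hypotheses and `g ≥ 2`, `G` is hyperelliptic (and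
`ι` is its hyperelliptic involution, `tree_involution_unique`). [cite: BakerNorine2009, Theorem 58
((5) ⇒ (1))] -/
theorem isHyperelliptic_of_forall_flow [IsDomain R] [CharZero R] (hG : G.Connected)
    (h2 : G.IsEdgeConnected 2) (hg : 2 ≤ genus G) {ι : V → V} (hι : IsInvolutiveAut G ι)
    (hs : HasSimpleEdgeOrbits G ι)
    (h5 : ∀ ω : V → V → R, IsGraphFlow G ω → ∀ u x, ω (ι u) (ι x) = -ω u x) : IsHyperelliptic G :=
  isHyperelliptic_of_isTree_quotientGraph hG h2 (two_lt_card_of_two_le_genus hG hg) hι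
    (isTree_quotientGraph_of_forall_flow hG h2 hι hs h5) hs hg

/-! ### §5 Theorem 58 (2) ⇔ (5) and (3) ⇔ (5) -/

/-- **Theorem 58 (2) ⇔ (5)**: for an involutive automorphism `γ` with simple edge orbits of a
connected 2-edge-connected graph of genus `g ≥ 2`, `γ_* = −1` on `Jac(G)` iff `γ^* = −1` on the
flows (both being equivalent to «`G/γ` is a tree», Theorem 58 (1)).
[cite: BakerNorine2009, Theorem 58 ((2) ⇔ (5))] -/
theorem jacPushforward_eq_neg_iff_forall_flow [IsDomain R] [CharZero R] (hG : G.Connected)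
    (h2 : G.IsEdgeConnected 2) (hg : 2 ≤ genus G) (γ : G ≃g G) (hγ : IsInvolutiveAut G γ)
    (hs : HasSimpleEdgeOrbits G γ) :
    (∀ c : criticalGroup G, (isHarmonicMorphism_iso γ).jacPushforward c = -c) ↔
      ∀ ω : V → V → R, IsGraphFlow G ω → ∀ u x, ω (γ u) (γ x) = -ω u x := by
  rw [← isTree_quotientGraph_iff_jacPushforward_eq_neg hG h2 hg γ,
    ← isTree_quotientGraph_iff_forall_flow (R := R) hG h2 hγ hs]
  exact ⟨fun h => h.2.1, fun h => ⟨hγ, h, hs⟩⟩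

/-- **Theorem 58 (3) ⇔ (5)**: likewise `γ^* = −1` on `Jac(G)` iff `γ^* = −1` on the flows.
[cite: BakerNorine2009, Theorem 58 ((3) ⇔ (5))] -/
theorem jacPullback_eq_neg_iff_forall_flow [IsDomain R] [CharZero R] (hG : G.Connected)
    (h2 : G.IsEdgeConnected 2) (hg : 2 ≤ genus G) (γ : G ≃g G) (hγ : IsInvolutiveAut G γ)
    (hs : HasSimpleEdgeOrbits G γ) :
    (∀ c : criticalGroup G, (isHarmonicMorphism_iso γ).jacPullback hG c = -c) ↔
      ∀ ω : V → V → R, IsGraphFlow G ω → ∀ u x, ω (γ u) (γ x) = -ω u x := by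
  rw [← isTree_quotientGraph_iff_jacPullback_eq_neg hG h2 hg γ,
    ← isTree_quotientGraph_iff_forall_flow (R := R) hG h2 hγ hs]
  exact ⟨fun h => h.2.1, fun h => ⟨hγ, h, hs⟩⟩

end Literature.Combinatorics.SimpleGraph.BakerNorine
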